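import Summits.ResolutionOfSingularities.ResolutionOfSingularities.Theorems.PurelyInseparableDim4ResConeCInfPinningUTwoStateRowPrime
import HarnessLib
import HarnessLib.Audit.Tags

/-!
# Purely inseparable four-folds — PINNING OF THE FREE PASSIVE LETTER FOR EVERY σ = (n, n) + 0 ((VT-u) at slot weight `n`, every row):
# a slot step of a twin-slot presented state of order `p + n` (`n + d = p`) with dead `(u,f)`-row `(eu, ef)`, `eu + ef = d − 2`, and flag
# `coeff (r + κ + o + (eu+1)u + ef·f) ≠ 0`, whose child keeps order `p + n` and `e_G = 3`, has no `u`-translation (cell `res-dim4-pi`,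
# K2(p) lane, B-LF (iii-b) class (iii), virtual port 1 ↦ n of the C∞ window, FILE P1 = W4a′ p714639 with `1 ↦ n`)

[OURS · counted 0 · cell `res-dim4-pi` · K2(p) lane (holder res-dim4-p-12 g5, ruling g5-21 (α); sentence of record: «Q-FLAG (the u-row flag)
is INTRINSIC to every w = 0 class» — this file is where the flag `hV` is consumed).]  Nothing here proves K2(p) for any `p`, any
TAIL(p, d, 3), `NoIsolatedTrap p p` or resolution of singularities in dimension ≥ 4 / characteristic `p` — NOT proved.  AI kernel work,
weaker than expert review.  A two-state reading lemma for OUR frame; kills nothing by itself.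

THE READING (W4a′ verbatim with `1 ↦ n`).  Chart `κ`, other slot `o` (weights `n`), free letters `u`, `f`; `r = n·κ + n·o`, order `p + n`,
`x^r ∣ F`, straight residual cone `a·x_f^d`, SLOT LEDGER (`e_f ≤ d − 1 ⇒ e_κ, e_o ≥ n + 1`), dead ROW `(eu, ef)` below degree `N ≥ p + n + 2`,
FLAG `V = coeff (r + κ + o + (eu+1)·u + ef·f) F ≠ 0`.  A step in chart `κ` with translation `β·e_u` keeping order `p + n` and `e_G = 3` has
its birth layer aligned with `x_f^{d−1}` (`exists_births_eq_mul_of_finrank_step_eq_three`, `p < p + n < 2p − 1`, `d < p`); the birth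
at `o + eu·u + ef·f` reads `0 + (eu+1)·β·V + C(eu+2,2)·β²·0` through the one-letter shear (dead-row entry and slot-ledger entry vanish), so
`(eu + 1)·β·V = 0`, and `eu + 1 ≤ d − 1 < p` gives `β = 0`.
* §1 `step_r_single_free_eq_sigma0` — the twin weights survive the slot step with a `u`-translation.
* §2 **`cInf_translation_u_eq_zero_sigma0_core`** (chart `κ`) and **`cInf_translation_u_eq_zero_sigma0`** (chart `ℓ ∈ {λ, μ}`, fixed
  letters `λ μ | u f` — the `hVTu` binder shape of the frame file).
[cite: CossartJannsenSaito2020, Thm. 3.10(4), Thm. 9.3] [cite: Hauser2010, §§F, I]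
bears_on: LADDER-RESOLUTION:D157-DOOR2 (res-dim4-pi · K2(p) B-LF (iii-b) class (iii) virtual port P1).  Supports
stmt-ResolutionOfSingularities-16155 (helper).
-/

set_option linter.dupNamespace false -- mandated namespace of this single-conjunct summit

noncomputable section

namespace Summit.ResolutionOfSingularities.ResolutionOfSingularities.Theorems.PIDim4

namespace ResCone

open MvPolynomial Finset
open Literature.AlgebraicGeometry.Resolution
open Literature.AlgebraicGeometry.Resolution.CentreBlowup
open Literature.AlgebraicGeometry.Resolution.Hauser2010
open Literature.AlgebraicGeometry.Resolution.HauserPerlega2019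
open PointBlowup (polarMap additiveSubspace)

variable {K : Type} [Field K] [DecidableEq K]

/-! ## §1 The twin weights survive a slot step with a free translation -/

/-- The twin ledger `n·κ + n·o` survives the slot step in chart `κ` with a `u`-translation (order `p + n`). [OURS · bookkeeping]
[cite: HauserPerlega2019PRIMS, §2 (transform D′ of D)] -/
theorem step_r_single_free_eq_sigma0 (p : ℕ) {n : ℕ} {κ o u f : Fin 4} (hκo : κ ≠ o) (hκu : κ ≠ u) (hκf : κ ≠ f) (hou : o ≠ u)
    (hof : o ≠ f) (huf : u ≠ f) {s : State K} (hr : s.r = Finsupp.single κ n + Finsupp.single o n)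
    (ho : ordZero s.F = ((p + n : ℕ) : ℕ∞)) (hdiv : ∀ e ∈ s.F.support, s.r ≤ e) (β : K) :
    (CentreBlowup.step p Finset.univ κ (Pi.single u β) s).r = Finsupp.single κ n + Finsupp.single o n := by
  have hbκ : (Pi.single u β : Fin 4 → K) κ = 0 := by rw [Pi.single_eq_of_ne hκu]
  rw [step_r_univ p κ hbκ s ho hdiv, hr, show p + n - p = n by omega]
  have hr4 : (Finsupp.single κ n + Finsupp.single o n : Fin 4 →₀ ℕ) =
      Finsupp.single κ n + Finsupp.single o n + Finsupp.single u 0 + Finsupp.single f 0 := by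
    rw [Finsupp.single_zero, Finsupp.single_zero, add_zero, add_zero]
  obtain ⟨h1, h2, h3, h4⟩ := quad_apply hκo hκu hκf hou hof huf n n 0 0
  rw [← hr4] at h1 h2 h3 h4
  ext i
  rw [Finsupp.update_apply, Finsupp.filter_apply]
  rcases letters_exhaust hκo hκu hκf hou hof huf i with h | h | h | h <;> rw [h]
  · rw [if_pos rfl, h1]
  · rw [if_neg hκo.symm, if_pos (show (Pi.single u β : Fin 4 → K) o = 0 by rw [Pi.single_eq_of_ne hou]), h2]
  · rw [if_neg hκu.symm, h3]; exact ite_self 0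
  · rw [if_neg hκf.symm, h4]; exact ite_self 0

/-! ## §2 (VT-u) at slot weight `n`, every row -/

/-- **(VT-u), TWO-STATE CORE, every σ = (n, n) + 0, every row** (chart `κ`, other slot `o`, free letters `u`, `f`): see the module
docstring. [OURS] [cite: CossartJannsenSaito2020, Thm. 3.10(4), Thm. 9.3] [cite: Hauser2010, §§F, I] -/
theorem cInf_translation_u_eq_zero_sigma0_core (p : ℕ) [Fact p.Prime] [CharP K p] {n d : ℕ} (hσ : n + d = p) (hn : 0 < n)
    (hd2 : 2 ≤ d) {κ o u f : Fin 4} (hκo : κ ≠ o) (hκu : κ ≠ u) (hκf : κ ≠ f) (hou : o ≠ u) (hof : o ≠ f) (huf : u ≠ f)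
    {s : State K} (hr : s.r = Finsupp.single κ n + Finsupp.single o n) (ho : ordZero s.F = ((p + n : ℕ) : ℕ∞))
    (hdiv : ∀ e ∈ s.F.support, s.r ≤ e) {a : K} (ha : a ≠ 0) (hform : resForm s = C a * X f ^ d)
    (hled : ∀ e ∈ s.F.support, e f ≤ d - 1 → n + 1 ≤ e κ ∧ n + 1 ≤ e o) {N eu ef : ℕ} (hef : eu + ef = d - 2)
    (hN : p + n + 2 ≤ N)
    (hrow : ∀ e ∈ s.F.support, e.degree < N → ¬ (e u = eu ∧ e f = ef))
    (hV : coeff (s.r + (Finsupp.single κ 1 + Finsupp.single o 1 + Finsupp.single u (eu + 1) + Finsupp.single f ef)) s.F ≠ 0)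
    {β : K} (ho' : ordZero (CentreBlowup.step p Finset.univ κ (Pi.single u β) s).F = ((p + n : ℕ) : ℕ∞))
    (he3' : Module.finrank K (resVertex (CentreBlowup.step p Finset.univ κ (Pi.single u β) s)) = 3) : β = 0 := by
  classical
  have hp : p.Prime := Fact.out
  have hp2 : 2 ≤ p := hp.two_le
  have hbκ : (Pi.single u β : Fin 4 → K) κ = 0 := by rw [Pi.single_eq_of_ne hκu]
  have hrdeg : s.r.degree = 2 * n := by rw [hr, map_add, Finsupp.degree_single, Finsupp.degree_single]; ring
  -- the shade is kept
  have hr' := step_r_single_free_eq_sigma0 p hκo hκu hκf hou hof huf hr ho hdiv β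
  have hrdeg' : (CentreBlowup.step p Finset.univ κ (Pi.single u β) s).r.degree = 2 * n := by
    rw [hr', map_add, Finsupp.degree_single, Finsupp.degree_single]; ring
  have heq : (CentreBlowup.step p Finset.univ κ (Pi.single u β) s).shade = s.shade := by
    rw [BandShade.shade_eq_coe ho', BandShade.shade_eq_coe ho, hrdeg, hrdeg']
  -- the parent's vertex is `{w_f = 0}`
  have hV0 : ∀ w, w ∈ resVertex s ↔ dotProduct (Pi.single f (1 : K)) w = 0 :=
    mem_resVertex_iff_of_resForm_eq_C_mul_X_pow p ha (n := d) (by omega) (by omega) hform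
  have hℓ0 : (Pi.single f (1 : K) : Fin 4 → K) ≠ 0 := fun h => by
    have h1 := congr_fun h f
    rw [Pi.single_eq_same, Pi.zero_apply] at h1
    exact one_ne_zero h1
  -- the birth layer is aligned with `x_f^{d−1}`
  obtain ⟨κ', hB⟩ := exists_births_eq_mul_of_finrank_step_eq_three p κ hbκ ho hdiv (by omega) (by omega) heq
    (by rw [hrdeg]; omega) hV0 hℓ0 he3'
  -- the birth at `μ₀ = e_o + (d−2)e_u` vanishes
  set μ₀ : Fin 4 →₀ ℕ := Finsupp.single o 1 + Finsupp.single u eu + Finsupp.single f ef with hμ₀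
  have hμ₀κ : μ₀ κ = 0 := by
    rw [hμ₀, Finsupp.add_apply, Finsupp.add_apply, Finsupp.single_eq_of_ne hκo, Finsupp.single_eq_of_ne hκu,
      Finsupp.single_eq_of_ne hκf, add_zero, add_zero]
  have hμ₀deg : μ₀.degree + 1 = p + n - s.r.degree := by
    rw [hrdeg, hμ₀, map_add, map_add, Finsupp.degree_single, Finsupp.degree_single, Finsupp.degree_single]
    omega
  have hBμ := hB μ₀ hμ₀κ hμ₀deg
  have hupd0 : Function.update (Pi.single f (1 : K) : Fin 4 → K) κ 0 = (Pi.single f (1 : K) : Fin 4 → K) := by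
    funext i
    by_cases hi : i = κ
    · subst hi; rw [Function.update_self, Pi.single_eq_of_ne hκf]
    · rw [Function.update_of_ne hi]
  have hsum : (∑ i, C ((Pi.single f (1 : K) : Fin 4 → K) i) * X i : MvPolynomial (Fin 4) K) = X f := by
    rw [Finset.sum_eq_single f (fun i _ hif => by rw [Pi.single_eq_of_ne hif, C_0, zero_mul])
      (fun h => absurd (Finset.mem_univ f) h), Pi.single_eq_same, C_1, one_mul]
  have hcoef0 : coeff μ₀ ((∑ i, C (Function.update (Pi.single f (1 : K) : Fin 4 → K) κ 0 i) * X i :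
      MvPolynomial (Fin 4) K) ^ (p + n - s.r.degree - 1)) = 0 := by
    rw [hupd0, hsum, hrdeg, X_pow_eq_monomial, coeff_monomial, if_neg]
    intro h
    have h1 := DFunLike.congr_fun h o
    rw [Finsupp.single_eq_of_ne hof, hμ₀, Finsupp.add_apply, Finsupp.add_apply, Finsupp.single_eq_same,
      Finsupp.single_eq_of_ne hou, Finsupp.single_eq_of_ne hof] at h1
    omega
  rw [hcoef0, mul_zero] at hBμ
  -- read the birth through the one-letter shear: `1·0 + (eu+1)·β·V + C(eu+2,2)·β²·0`
  rw [coeff_shear_single hκu β] at hBμ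
  have heκ : (μ₀ + Finsupp.single κ 2 : Fin 4 →₀ ℕ) κ = 2 := by
    rw [Finsupp.add_apply, hμ₀κ, Finsupp.single_eq_same]
  have heu : (μ₀ + Finsupp.single κ 2 : Fin 4 →₀ ℕ) u = eu := by
    rw [Finsupp.add_apply, hμ₀, Finsupp.add_apply, Finsupp.add_apply, Finsupp.single_eq_of_ne hou.symm, Finsupp.single_eq_same,
      Finsupp.single_eq_of_ne huf, Finsupp.single_eq_of_ne hκu.symm, zero_add, add_zero, add_zero]
  rw [heκ, heu, Finset.sum_range_succ, Finset.sum_range_succ, Finset.sum_range_succ, Finset.sum_range_zero,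
    zero_add] at hBμ
  -- the three exponents, in `F`-coordinates
  have hupd : ∀ x y x' y' : ℕ, x = x' → y = y' →
      ((μ₀ + Finsupp.single κ 2).update κ x).update u y =
        Finsupp.single κ x' + Finsupp.single o 1 + Finsupp.single u y' + Finsupp.single f ef := by
    intro x y x' y' hx hy
    subst hx; subst hy
    obtain ⟨h1, h2, h3, h4⟩ := quad_apply hκo hκu hκf hou hof huf x 1 y ef
    ext i
    simp only [Finsupp.coe_update]
    rcases letters_exhaust hκo hκu hκf hou hof huf i with h | h | h | h <;> rw [h]
    · rw [Function.update_of_ne hκu, Function.update_self, h1]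
    · rw [Function.update_of_ne hou, Function.update_of_ne hκo.symm, h2, Finsupp.add_apply, hμ₀, Finsupp.add_apply,
        Finsupp.add_apply, Finsupp.single_eq_same, Finsupp.single_eq_of_ne hou, Finsupp.single_eq_of_ne hof,
        Finsupp.single_eq_of_ne hκo.symm]
      omega
    · rw [Function.update_self, h3]
    · rw [Function.update_of_ne huf.symm, Function.update_of_ne hκf.symm, h4, Finsupp.add_apply, hμ₀,
        Finsupp.add_apply, Finsupp.add_apply, Finsupp.single_eq_of_ne hof.symm, Finsupp.single_eq_of_ne huf.symm,
        Finsupp.single_eq_same, Finsupp.single_eq_of_ne hκf.symm]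
      omega
  have he0 : ((μ₀ + Finsupp.single κ 2).update κ (2 - 0)).update u (eu + 0) =
      Finsupp.single κ 2 + Finsupp.single o 1 + Finsupp.single u eu + Finsupp.single f ef := hupd _ _ 2 eu rfl rfl
  have he1 : ((μ₀ + Finsupp.single κ 2).update κ (2 - 1)).update u (eu + 1) =
      Finsupp.single κ 1 + Finsupp.single o 1 + Finsupp.single u (eu + 1) + Finsupp.single f ef := hupd _ _ 1 (eu + 1) rfl rfl
  have he2 : ((μ₀ + Finsupp.single κ 2).update κ (2 - 2)).update u (eu + 2) =
      Finsupp.single κ 0 + Finsupp.single o 1 + Finsupp.single u (eu + 2) + Finsupp.single f ef := hupd _ _ 0 (eu + 2) rfl rfl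
  -- the dead ROW entry (degree `p + n + 1 < N`)
  have hnf : coeff (s.r + (Finsupp.single κ 2 + Finsupp.single o 1 + Finsupp.single u eu + Finsupp.single f ef)) s.F = 0 := by
    by_contra h
    have hmem := mem_support_iff.mpr h
    obtain ⟨-, -, h3, h4⟩ := quad_apply hκo hκu hκf hou hof huf (n + 2) (n + 1) eu ef
    have heq' : s.r + (Finsupp.single κ 2 + Finsupp.single o 1 + Finsupp.single u eu + Finsupp.single f ef) =
        Finsupp.single κ (n + 2) + Finsupp.single o (n + 1) + Finsupp.single u eu + Finsupp.single f ef := by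
      rw [hr]
      ext i
      rcases letters_exhaust hκo hκu hκf hou hof huf i with h | h | h | h <;> subst h <;>
        simp [Finsupp.add_apply, hκo, hκu, hκf, hou, hof, huf, hκo.symm, hκu.symm, hκf.symm, hou.symm, hof.symm, huf.symm]
    rw [heq'] at hmem
    exact hrow _ hmem (by rw [degree_quad]; omega) ⟨h3, h4⟩
  -- the slot-ledger entry (`κ`-exponent `n < n + 1` at `f`-degree `ef ≤ d − 2`)
  have hW : coeff (s.r + (Finsupp.single κ 0 + Finsupp.single o 1 + Finsupp.single u (eu + 2) + Finsupp.single f ef)) s.F = 0 := by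
    by_contra h
    have hmem := mem_support_iff.mpr h
    obtain ⟨h1, -, -, h4⟩ := quad_apply hκo hκu hκf hou hof huf (n + 0) (n + 1) (eu + 2) ef
    have heq' : s.r + (Finsupp.single κ 0 + Finsupp.single o 1 + Finsupp.single u (eu + 2) + Finsupp.single f ef) =
        Finsupp.single κ (n + 0) + Finsupp.single o (n + 1) + Finsupp.single u (eu + 2) + Finsupp.single f ef := by
      rw [hr]
      ext i
      rcases letters_exhaust hκo hκu hκf hou hof huf i with h | h | h | h <;> subst h <;>
        simp [Finsupp.add_apply, hκo, hκu, hκf, hou, hof, huf, hκo.symm, hκu.symm, hκf.symm, hou.symm, hof.symm, huf.symm]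
    rw [heq'] at hmem
    have h2 := (hled _ hmem (by rw [h4]; omega)).1
    rw [h1] at h2
    omega
  rw [he0, he1, he2, coeff_divMonomial, coeff_divMonomial, coeff_divMonomial, hnf, hW] at hBμ
  -- `hBμ : _ * 0 + (eu+1) * β * V + _ * 0 = 0`
  have h3 : ((eu + 1 : ℕ).choose 1 : K) ≠ 0 := by
    rw [Nat.choose_one_right]
    intro h
    exact Nat.not_dvd_of_pos_of_lt (by omega) (by omega) ((CharP.cast_eq_zero_iff K p _).mp h)
  have hkey : ((eu + 1 : ℕ).choose 1 : K) * β ^ 1 *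
      coeff (s.r + (Finsupp.single κ 1 + Finsupp.single o 1 + Finsupp.single u (eu + 1) + Finsupp.single f ef)) s.F = 0 := by
    have h := hBμ
    simp only [mul_zero, zero_add, add_zero] at h
    exact h
  rw [pow_one] at hkey
  rcases mul_eq_zero.mp hkey with h | h
  · rcases mul_eq_zero.mp h with h' | h'
    · exact absurd h' h3
    · exact h'
  · exact absurd h hV


/-- **(VT-u), TWO-STATE EXPORT, every σ = (n, n) + 0, every row** (the `hVTu` binder of the frame file): fixed letters `λ μ | u f`,
ledger `n·x_λ + n·x_μ`, order `p + n`, `x^r ∣ F`, straight residual cone `a·x_f^d`, slot ledger, dead ROW `(eu, ef)` (`eu + ef = d − 2`)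
below `N ≥ p + n + 2`, FLAG `coeff (r + λ + μ + (eu+1)u + ef·f) ≠ 0`; the child by a slot step `ℓ ∈ {λ, μ}` with translation supported
on `u` alone, again of order `p + n` with `e_G = 3`, has NO `u`-translation. [OURS] [cite: CossartJannsenSaito2020, Thm. 3.10(4), Thm. 9.3] -/
theorem cInf_translation_u_eq_zero_sigma0 (p : ℕ) [Fact p.Prime] [CharP K p] {n d : ℕ} (hσ : n + d = p) (hn : 0 < n)
    (hd2 : 2 ≤ d) {la mu u f : Fin 4} (hlm : la ≠ mu) (hlu : la ≠ u) (hlf : la ≠ f) (hmu : mu ≠ u) (hmf : mu ≠ f)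
    (huf : u ≠ f) {s : State K} {ℓ : Fin 4} (hℓ : ℓ = la ∨ ℓ = mu) (hr : s.r = Finsupp.single la n + Finsupp.single mu n)
    (ho : ordZero s.F = ((p + n : ℕ) : ℕ∞)) (hdiv : ∀ e ∈ s.F.support, s.r ≤ e) {a : K} (ha : a ≠ 0)
    (hform : resForm s = C a * X f ^ d) (hled : ∀ e ∈ s.F.support, e f ≤ d - 1 → n + 1 ≤ e la ∧ n + 1 ≤ e mu) {N eu ef : ℕ}
    (hef : eu + ef = d - 2) (hN : p + n + 2 ≤ N) (hrow : ∀ e ∈ s.F.support, e.degree < N → ¬ (e u = eu ∧ e f = ef))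
    (hV : coeff (s.r + (Finsupp.single la 1 + Finsupp.single mu 1 + Finsupp.single u (eu + 1) + Finsupp.single f ef)) s.F ≠ 0)
    {β : K} (ho' : ordZero (CentreBlowup.step p Finset.univ ℓ (Pi.single u β) s).F = ((p + n : ℕ) : ℕ∞))
    (he3' : Module.finrank K (resVertex (CentreBlowup.step p Finset.univ ℓ (Pi.single u β) s)) = 3) : β = 0 := by
  rcases hℓ with h | h <;> subst h
  · exact cInf_translation_u_eq_zero_sigma0_core p hσ hn hd2 hlm hlu hlf hmu hmf huf hr ho hdiv ha hform hled hef hN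
      hrow hV ho' he3'
  · refine cInf_translation_u_eq_zero_sigma0_core p hσ hn hd2 hlm.symm hmu hmf hlu hlf huf (by rw [hr, add_comm]) ho
      hdiv ha hform (fun e he hf => (hled e he hf).symm) hef hN hrow ?_ ho' he3'
    rw [show (Finsupp.single ℓ 1 + Finsupp.single la 1 + Finsupp.single u (eu + 1) + Finsupp.single f ef : Fin 4 →₀ ℕ) =
      Finsupp.single la 1 + Finsupp.single ℓ 1 + Finsupp.single u (eu + 1) + Finsupp.single f ef by abel]
    exact hV

end ResCone

end Summit.ResolutionOfSingularities.ResolutionOfSingularities.Theorems.PIDim4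

end
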